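/-
Copyright: lit-balaban Phase-2 proof seat p29 (gen 34).  Statement-level skeleton of a published paper; no proof claims beyond what the
kernel checks below.
-/
import Literature.MathematicalPhysics.QuantumFieldTheory.BalabanImbrieJaffe1984to88.BIJ88Loc231RegionOfInputs
import Literature.MathematicalPhysics.QuantumFieldTheory.BalabanImbrieJaffe1984to88.BIJ88NeumannPropagatorSmoothNearCloseDeriv

/-!
# `BalabanImbrieJaffe1984to88.BIJ88Loc231SmoothNearRegion` — T. Bałaban, J. Imbrie, A. Jaffe, *Effective action and cluster properties of the
abelian Higgs model*, Commun. Math. Phys. **114** (1988) 257–315 [BalabanImbrieJaffe1988], Sect. 2 p. 263 [PDF 7], (2.31) with its printed hypothesis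
(2.32) and the sentence after (2.33) — **THE COVARIANT-DERIVATIVE ANALOGUE AND THE HÖLDER-`θ ≤ 1` MEMBER OF (2.31) FOR A GENERAL `k`-BLOCK REGION
`Ω ⊇ Ω₀`, PRINTED TORUS DATA OF RECORD, UNDER THE PRINTED LOCAL HYPOTHESIS — `u` PLAQUETTE-SMALL NEAR `Ω` ONLY —, HYPOTHESIS-FREE**: gen 30's
hypothesis-form region members `BIJ88Loc231RegionOfInputs.{deriv231, holder231, exists_contour_holder231}_region_of_inputs` with their four
[6]-inputs DISCHARGED at a `U(1)` field with `‖u(∂p) − 1‖ ≤ θ` for the plaquettes based within `2L^k` of `Ω` (`(L^{2k}θ)² ≤ 1/500`; no gauge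
condition, nothing assumed away from `Ω` — print's (2.32) *"for (2.31) we assume smoothness throughout the subset Ω ⊂ T_η"*), by the providers of
record: p34 gen 21's hypothesis-free local-hypothesis region instances `close112_smoothNear_region_deriv` / `close112_smoothNear_region` ((1.11)–(1.12)
for nested block unions `□ ⊆ Ω`; covariant derivative at the `L^k`-deep rows of `□`, values at every row — files C-I `BIJ88NeumannPropagatorSmoothNearClose`
/ C-III `…CloseDeriv`) and `inputs110_smoothNear_region` (the (1.10) members of `G_k(Ω,u)` — p34's B-I / B-II `BIJ88NeumannPropagatorSmoothNearRegion[Holder]`).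
The twin of gen 30's `BIJ88Loc231SmallPlaquetteRegion` (global plaquette hypothesis) with the hypothesis LOCALISED as printed; plus all three members
under r18's typed (2.32) `SmoothOn` (p34's `plaqSmall_near_of_smoothOn`).

statement-level skeleton of published theorems with citation tags; proofs where landed; nothing here is a claim about the Yang–Mills mass gap

PDF held: `paper:balaban1988-cmp114-bij-abelian-higgs-effective-action` (journal page = PDF page + 256); p. 263 [PDF 7] re-read this session (text layer).

CITATION HEADER (lean-in-tree rule).  Part of the lit-balaban TYPED SKELETON (HOME `run/shared/lean/pub/lit-balaban/`), PHASE-2 proof seat p29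
gen 34 (unit `lit-balaban-p29`; own lineage — gen 33's HANDOFF item (3), agreed with p34 g21 12:31Z / 13:28Z «the three Loc231 instances are YOUR
successor's»; TAKING #2 line HOME/STATUS.md 2026-08-23T13:45Z, free-target protocol G.5-34(d)).  Rows **C2.Claim@263** / **C2.Eq2.31** (owner r18; LOCATED members — the D / Hθ cells of r18's
`C2S14-CLOSURE` §6 row «u smooth NEAR Ω only — the printed (2.32)»; the V cell is p34's C-II `BIJ88DeltaLocSmoothNearRegionCwt`) and
**C1.Eq7.3.1-7.3.2** (owner r15).  Kind: theorems only (no definition, no `Prop`-valued fact).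

THE PRINTED TEXT (p. 263, verbatim, print order).  *"|(G_{k,loc}(u)f − G_k(Ω,u)f)(x)| ≦ e^{−cr(e_k)}e^{−c dist(suppt f,x)}‖f‖_∞, (2.31) for
dist(x, Ω^c) ≧ O(r(e_k)). … We assume that u is smooth in the □_α's entering the sum in (2.27); for (2.31) we assume smoothness throughout the
subset Ω ⊂ T_η. This means that in a neighborhood of each □_α there exists an A, λ such that u = exp[ie_kη(A + ∂λ)] with |∂A|, |∂*A| ≦ O(p(e_k)).
(2.32) … Bounds analogous to (2.30), (2.31) hold for covariant derivatives and Hölder derivatives of G_{k,loc}(u) of order less than two."*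

THE MECHANISM (declared).  §1 packages the four inputs of `deriv231_region_of_inputs` for EVERY `k`-block union `Ω` at ONE pair of constants
`(c₀, δ₀)` depending on `(d, ℓ, a)` only, from p34's three packaged local-hypothesis region theorems, constants aligned by monotonicity; input depth
`ρ = L^k`.  §2 = gen 30's region members ∘ §1 — the proofs are gen 30's verbatim with the plaquette hypothesis localised.  §3 = §2's members
with the local plaquette hypothesis discharged from `SmoothOn` (p34's `plaqSmall_near_of_smoothOn`, threshold `(L^{2k}·e_kη²C𝓅)² ≤ 1/500`).

WHAT IS PROVED (theorems only; 0 `sorry`; standard axioms).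
* §1 **`inputs_smoothNear_region`** — (H1)–(H4) of `deriv231_region_of_inputs` with `ρ = L^k`, for every `k`-block union `Ω` and every field
  plaquette-small near `Ω`.
* §2 **`deriv231_smoothNear_region`**, **`holder231_smoothNear_region`**, **`exists_contour_holder231_smoothNear_region`** — the statements of gen 30's
  `…_smallPlaquette_region` members VERBATIM except for the plaquette hypothesis, now `∀ p, (∃ y ∈ Ω, |y − p.src|_∞ ≤ 2L^k) → ‖u(∂p) − 1‖ ≤ θ`.
* §3 **`deriv231_smoothOn_region`**, **`holder231_smoothOn_region`**, **`exists_contour_holder231_smoothOn_region`** — §2's members under r18's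
  `SmoothOn e_k η C 𝓅 X Bd Pl (cfg u)` with `Pl ⊇` the plaquettes based within `2L^k` of `Ω` and `Bd ⊇` their bonds (threshold `(L^{2k}e_kη²C𝓅)² ≤ 1/500`).
HONEST SCOPE / DIVERGENCE.  (i)–(vi) as gen 30's `BIJ88Loc231SmallPlaquetteRegion` (`2 ≤ d + 1 ≤ 3`, `L = ℓ + 1` odd `≥ 3`; `Ω` a union of
`k`-blocks containing `Ω₀`; block-scale smallness `(L^{2k}θ)² ≤ 1/500`; deep bonds only; providers' method divergence — maximum principle / Agmon /
local gradient estimate instead of print's random walk; constants not optimized).  (vii) The plaquette hypothesis is the printed LOCAL one; nothing is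
assumed on `u` away from the `2L^k`-neighbourhood of `Ω`.  Imports: gen 30's `BIJ88Loc231RegionOfInputs`; p34 gen 21's `BIJ88NeumannPropagatorSmoothNearCloseDeriv` (→ C-I `…SmoothNearClose`,
B-I/B-II `…SmoothNearRegion[Holder]`, p30's `…SmallFieldCloseDeriv`).
Literature + Mathlib only.  Unit `lit-balaban-p29` (literature-prover-lit-balaban-p29-g34-0), 2026-08-23.  NOT summit progress.
-/

open scoped BigOperators Matrix ComplexConjugate
open Finset Matrix

namespace Literature.MathematicalPhysics.QuantumFieldTheory.BalabanImbrieJaffe1984to88.BIJ88Loc231SmoothNearRegion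

open Literature.MathematicalPhysics.QuantumFieldTheory.Balaban1983to89
open BIJ88Sect3Statements (U1 toC cfg covD)
open BIJ85BlockAveragesTorus BIJ85BlockAveragesTorusK
open BIJ88NeumannPropagator227Torus (gBox)
open BIJ88DeltaLoc234Torus (gLocT)
open BIJ88NeumannPropagatorFlatDecayCube (cubeT boxCoord isBlockUnion_cubeT)
open BIJ88Cutoffs21 (cutoff)
open BIJ88LocWeights227Torus
open BIJ88NeumannNoZeroModesTorus (IsBlockUnion)
open BIJ88NeumannPropagatorSmoothNearCloseDeriv (inputs110_smoothNear_region close112_smoothNear_region close112_smoothNear_region_deriv)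
open LatticeFieldCalculus (supDist)
open GaugeField (plaqHol)
open BIJ88Sect2Statements (SmoothOn)
open BIJ88NeumannPropagatorSmoothNearRegion (plaqSmall_near_of_smoothOn)
open BIJ88Loc231RegionOfInputs (deriv231_region_of_inputs holder231_region_of_inputs exists_contour_holder231_region_of_inputs)
open T4TreeGaugeFixing (Joins)
open T4TreeGaugeTransform (chainHol)

noncomputable section

variable {d : ℕ} {P : Params}

/-! ## §1 The four [6]-inputs for a block-union region at a field plaquette-small NEAR it, at one pair of constants -/

/-- kernel: `e^{−δ'E} ≤ e^{−δE}` for `δ ≤ δ'`, `E ≥ 0`. [folklore] -/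
private theorem exp_le_exp_of_rate {δ δ' E : ℝ} (hδ : δ ≤ δ') (hE : 0 ≤ E) : Real.exp (-(δ' * E)) ≤ Real.exp (-(δ * E)) :=
  Real.exp_le_exp.2 (neg_le_neg (mul_le_mul_of_nonneg_right hδ hE))

/-- kernel: monotonicity of a bound `c·e^{−δE}·F` in the constant and the rate. [folklore] -/
private theorem bound_mono {c C δ Δ E F : ℝ} (hc : 0 ≤ c) (hcC : c ≤ C) (hΔ : Δ ≤ δ) (hE : 0 ≤ E) (hF : 0 ≤ F) :
    c * Real.exp (-(δ * E)) * F ≤ C * Real.exp (-(Δ * E)) * F :=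
  mul_le_mul_of_nonneg_right (mul_le_mul hcC (exp_le_exp_of_rate hΔ hE) (Real.exp_pos _).le (hc.trans hcC)) hF

/-- kernel: the same with the (1.12) bracket. [folklore] -/
private theorem bound_mono₂ {c C δ Δ E E' F : ℝ} (hc : 0 ≤ c) (hcC : c ≤ C) (hΔ : Δ ≤ δ) (hE : 0 ≤ E) (hE' : 0 ≤ E') (hF : 0 ≤ F) :
    c * Real.exp (-(δ * E)) * Real.exp (-(δ * E')) * F ≤ C * Real.exp (-(Δ * E)) * Real.exp (-(Δ * E')) * F :=
  mul_le_mul_of_nonneg_right (mul_le_mul (mul_le_mul hcC (exp_le_exp_of_rate hΔ hE) (Real.exp_pos _).le (hc.trans hcC))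
    (exp_le_exp_of_rate hΔ hE') (Real.exp_pos _).le (mul_nonneg (hc.trans hcC) (Real.exp_pos _).le)) hF

set_option maxHeartbeats 400000 in
/-- **THE FOUR [6]-INPUTS OF `deriv231_region_of_inputs` FOR EVERY `k`-BLOCK UNION `Ω` AT A FIELD PLAQUETTE-SMALL NEAR `Ω` ONLY (THE PRINTED (2.32)), AT ONE PAIR OF CONSTANTS**
([BalabanImbrieJaffe1985] p. 326 (7.3.1); [6] = [Balaban1983RegularityDecay] Theorem p. 573 (1.10)–(1.12)): for `1 ≤ d`, `d + 1 ≤ 3`, `ℓ ≥ 1`,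
`ℓ + 1` odd, `a > 0`, THERE ARE `δ₀, c₀ > 0` depending on `(d, ℓ, a)` only such that on every torus (`P.d = d+1`, `P.L = ℓ+1`), at every
`1 ≤ k ≤ K` with `2(L^k−1) + 4 < |T^{(0)}|`, for every field with `|u(∂p) − 1| ≤ θ`, `0 ≤ θ`, `(L^{2k}θ)² ≤ 1/500` and every union `Ω` of
`k`-blocks: (H1) the (1.11)–(1.12) covariant-derivative closeness `G_k(□,u)` vs `G_k(Ω,u)` for every fitting no-wrap cube `□ ⊆ Ω` at its
`L^k`-deep rows, (H2) the value closeness there, (H3)/(H4) the (1.10) covariant-derivative / value members of `G_k(Ω,u)` at the `L^k`-deep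
rows of `Ω` (p34 gen 21's `close112_smoothNear_region_deriv` / `close112_smoothNear_region` / `inputs110_smoothNear_region`) —
all four at `(c₀, δ₀)`, binder shapes of `deriv231_region_of_inputs`.
[cite: BalabanImbrieJaffe1985, (7.3.1) p.326] [cite: Balaban1983RegularityDecay, Theorem p.573 (1.10)–(1.12)] [cite: BalabanImbrieJaffe1988, (2.31) p.263] -/
theorem inputs_smoothNear_region (d ℓ : ℕ) (hd1 : 1 ≤ d) (hd3 : d + 1 ≤ 3) (hℓ : 1 ≤ ℓ) (hodd : Odd (ℓ + 1)) {a : ℝ} (ha : 0 < a) :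
    ∃ δ₀ c₀ : ℝ, 0 < δ₀ ∧ 0 < c₀ ∧ ∀ (P : Params) (hPd : P.d = d + 1), P.L = ℓ + 1 →
      ∀ (k : ℕ), 1 ≤ k → k ≤ P.K → 2 * (P.L ^ k - 1) + 4 < P.sitesPerDir 0 →
      ∀ (U : GaugeField P 0 U1) (Ω : Finset (Balaban1983to89.Site P 0)) (θ : ℝ), 0 ≤ θ →
        (∀ p : Balaban1983to89.Plaq P 0, (∃ y ∈ Ω, supDist y p.src ≤ 2 * P.L ^ k) → ‖toC (plaqHol U p) - 1‖ ≤ θ) →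
        (((P.L : ℝ) ^ k) ^ 2 * θ) ^ 2 ≤ 1 / 500 → IsBlockUnion k Ω →
      (∀ (c' M' : Fin (d + 1) → ℕ), (∀ i, 1 ≤ M' i) → (∀ i, c' i * P.L ^ k + P.L ^ k * M' i ≤ P.sitesPerDir 0) →
          (∀ i, P.L ^ k * M' i < P.sitesPerDir 0) → (cubeT hPd (P.L ^ k) c' fun i => P.L ^ k * M' i) ⊆ Ω →
        ∀ (x : Balaban1983to89.Site P 0) (μ : Fin P.d), x ∈ (cubeT hPd (P.L ^ k) c' fun i => P.L ^ k * M' i) →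
          x.shift μ ∈ (cubeT hPd (P.L ^ k) c' fun i => P.L ^ k * M' i) →
          (∀ w, w ∉ (cubeT hPd (P.L ^ k) c' fun i => P.L ^ k * M' i) → (P.L : ℝ) ^ k ≤ B5Ineq137Torus.T P 0 x w) →
        ∀ (g : Balaban1983to89.Site P 0 → ℂ) (F D Db Df : ℝ), (∀ y, ‖g y‖ ≤ F) →
          (∀ y, y ∉ (cubeT hPd (P.L ^ k) c' fun i => P.L ^ k * M' i) → g y = 0) →
          0 ≤ D → (∀ y, g y ≠ 0 → D ≤ B5Ineq137Torus.T P 0 x y) →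
          0 ≤ Db → (∀ w, w ∉ (cubeT hPd (P.L ^ k) c' fun i => P.L ^ k * M' i) → Db ≤ B5Ineq137Torus.T P 0 x w) →
          0 ≤ Df → (∀ y, g y ≠ 0 → ∀ w, w ∉ (cubeT hPd (P.L ^ k) c' fun i => P.L ^ k * M' i) → Df ≤ B5Ineq137Torus.T P 0 y w) →
          ‖covD P.eps⁻¹ (cfg U) (gBox (B1RG242Torus.α P a k * (P.L : ℝ) ^ (k * P.d)) P.eps⁻¹ U k
                  (cubeT hPd (P.L ^ k) c' fun i => P.L ^ k * M' i) *ᵥ g) ⟨x, μ⟩ -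
              covD P.eps⁻¹ (cfg U) (gBox (B1RG242Torus.α P a k * (P.L : ℝ) ^ (k * P.d)) P.eps⁻¹ U k Ω *ᵥ g) ⟨x, μ⟩‖ ≤
            P.spacing k * (c₀ * Real.exp (-(δ₀ * (((P.L : ℝ) ^ k)⁻¹ * D))) * Real.exp (-(δ₀ * (((P.L : ℝ) ^ k)⁻¹ * (Db + Df)))) * F)) ∧
      (∀ (c' M' : Fin (d + 1) → ℕ), (∀ i, 1 ≤ M' i) → (∀ i, c' i * P.L ^ k + P.L ^ k * M' i ≤ P.sitesPerDir 0) →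
          (∀ i, P.L ^ k * M' i < P.sitesPerDir 0) → (cubeT hPd (P.L ^ k) c' fun i => P.L ^ k * M' i) ⊆ Ω →
        ∀ (x : Balaban1983to89.Site P 0), x ∈ (cubeT hPd (P.L ^ k) c' fun i => P.L ^ k * M' i) →
          (∀ w, w ∉ (cubeT hPd (P.L ^ k) c' fun i => P.L ^ k * M' i) → (P.L : ℝ) ^ k ≤ B5Ineq137Torus.T P 0 x w) →
        ∀ (g : Balaban1983to89.Site P 0 → ℂ) (F D Db Df : ℝ), (∀ y, ‖g y‖ ≤ F) →
          (∀ y, y ∉ (cubeT hPd (P.L ^ k) c' fun i => P.L ^ k * M' i) → g y = 0) →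
          0 ≤ D → (∀ y, g y ≠ 0 → D ≤ B5Ineq137Torus.T P 0 x y) →
          0 ≤ Db → (∀ w, w ∉ (cubeT hPd (P.L ^ k) c' fun i => P.L ^ k * M' i) → Db ≤ B5Ineq137Torus.T P 0 x w) →
          0 ≤ Df → (∀ y, g y ≠ 0 → ∀ w, w ∉ (cubeT hPd (P.L ^ k) c' fun i => P.L ^ k * M' i) → Df ≤ B5Ineq137Torus.T P 0 y w) →
          ‖(gBox (B1RG242Torus.α P a k * (P.L : ℝ) ^ (k * P.d)) P.eps⁻¹ U k (cubeT hPd (P.L ^ k) c' fun i => P.L ^ k * M' i) *ᵥ g) x -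
              (gBox (B1RG242Torus.α P a k * (P.L : ℝ) ^ (k * P.d)) P.eps⁻¹ U k Ω *ᵥ g) x‖ ≤
            P.spacing k ^ 2 * (c₀ * Real.exp (-(δ₀ * (((P.L : ℝ) ^ k)⁻¹ * D))) * Real.exp (-(δ₀ * (((P.L : ℝ) ^ k)⁻¹ * (Db + Df)))) * F)) ∧
      (∀ (x : Balaban1983to89.Site P 0), x ∈ Ω → (∀ w, w ∉ Ω → (P.L : ℝ) ^ k ≤ B5Ineq137Torus.T P 0 x w) →
        ∀ (μ : Fin P.d) (g : Balaban1983to89.Site P 0 → ℂ) (F D : ℝ), (∀ y, ‖g y‖ ≤ F) → 0 ≤ D →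
          (∀ y, g y ≠ 0 → D ≤ B5Ineq137Torus.T P 0 x y) →
          ‖covD P.eps⁻¹ (cfg U) (gBox (B1RG242Torus.α P a k * (P.L : ℝ) ^ (k * P.d)) P.eps⁻¹ U k Ω *ᵥ g) ⟨x, μ⟩‖ ≤
            P.spacing k * (c₀ * Real.exp (-(δ₀ * (((P.L : ℝ) ^ k)⁻¹ * D))) * F)) ∧
      (∀ (x : Balaban1983to89.Site P 0), x ∈ Ω → (∀ w, w ∉ Ω → (P.L : ℝ) ^ k ≤ B5Ineq137Torus.T P 0 x w) →
        ∀ (g : Balaban1983to89.Site P 0 → ℂ) (F D : ℝ), (∀ y, ‖g y‖ ≤ F) → 0 ≤ D →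
          (∀ y, g y ≠ 0 → D ≤ B5Ineq137Torus.T P 0 x y) →
          ‖(gBox (B1RG242Torus.α P a k * (P.L : ℝ) ^ (k * P.d)) P.eps⁻¹ U k Ω *ᵥ g) x‖ ≤
            P.spacing k ^ 2 * (c₀ * Real.exp (-(δ₀ * (((P.L : ℝ) ^ k)⁻¹ * D))) * F)) := by
  -- p34 gen 21's three packaged region theorems under the printed LOCAL hypothesis
  obtain ⟨c₁, δ₁, hc₁, hδ₁, H1p⟩ := close112_smoothNear_region_deriv d ℓ hd1 hd3 hℓ hodd ha
  obtain ⟨c₂, δ₂, hc₂, hδ₂, H2p⟩ := close112_smoothNear_region d ℓ hd1 hd3 hℓ hodd ha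
  obtain ⟨c₃, δ₃, hc₃, hδ₃, H34p⟩ := inputs110_smoothNear_region d ℓ hd1 hd3 hℓ hodd ha
  -- the common constants
  set δ₀ : ℝ := min (min δ₁ δ₂) δ₃ with hδ₀def
  set c₀ : ℝ := max (max c₁ c₂) c₃ with hc₀def
  have hδ₀ : 0 < δ₀ := lt_min (lt_min hδ₁ hδ₂) hδ₃
  have hc₀ : 0 < c₀ := lt_max_of_lt_left (lt_max_of_lt_left hc₁)
  have hc1_0 : c₁ ≤ c₀ := (le_max_left _ _).trans (le_max_left _ _)
  have hc2_0 : c₂ ≤ c₀ := (le_max_right _ _).trans (le_max_left _ _)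
  have hc3_0 : c₃ ≤ c₀ := le_max_right _ _
  have hδ1_0 : δ₀ ≤ δ₁ := (min_le_left _ _).trans (min_le_left _ _)
  have hδ2_0 : δ₀ ≤ δ₂ := (min_le_left _ _).trans (min_le_right _ _)
  have hδ3_0 : δ₀ ≤ δ₃ := min_le_right _ _
  refine ⟨δ₀, c₀, hδ₀, hc₀, ?_⟩
  intro P hPd hPL k hk1 hkK hbig U Ω θ hθ0 hθ hτ hΩ
  have hkm : k ≤ P.m + P.K := hkK.trans (Nat.le_add_left _ _)
  have hPk : (0 : ℝ) < (P.L : ℝ) ^ k := pow_pos P.cast_L_pos k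
  have hPkinv : 0 ≤ ((P.L : ℝ) ^ k)⁻¹ := (inv_pos.2 hPk).le
  have hsk : 0 < P.spacing k := P.spacing_pos k
  have hsk2 : 0 ≤ P.spacing k ^ 2 := sq_nonneg _
  set A : ℝ := B1RG242Torus.α P a k * (P.L : ℝ) ^ (k * P.d) with hAdef
  -- the (1.10) members of `G_k(Ω,u)` (the pair `(Ω, Ω)`)
  obtain ⟨-, -, -, HVΩ, -, HDΩ⟩ := H34p P hPd hPL k hk1 hkK hbig U Ω θ hθ0 hθ hτ Ω hΩ hΩ subset_rfl
  -- an `L^k`-deep row of `Ω` has its open `L^k`-ball in `Ω`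
  have hballΩ : ∀ (x : Balaban1983to89.Site P 0), (∀ w, w ∉ Ω → (P.L : ℝ) ^ k ≤ B5Ineq137Torus.T P 0 x w) →
      ∀ y, B5Ineq137Torus.T P 0 x y < (P.L : ℝ) ^ k → y ∈ Ω := by
    intro x hρ y hy
    by_contra hyΩ
    exact absurd (hρ y hyΩ) (not_le.2 hy)
  refine ⟨?_, ?_, ?_, ?_⟩
  · -- (H1): the covariant-derivative closeness for `□ ⊆ Ω`, rows `L^k`-deep in `□`
    intro c' M' hM' hfit' hN' hsub x μ hx _ hρx g F D Db Df hF hsuppg hD hsD hDb hsDb hDf hsDf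
    have hF0 : 0 ≤ F := (norm_nonneg _).trans (hF x)
    have hBU : IsBlockUnion k (cubeT hPd (P.L ^ k) c' fun i => P.L ^ k * M' i) := isBlockUnion_cubeT hPd hkm rfl hfit'
    exact (H1p P hPd hPL k hk1 hkK hbig U Ω θ hθ0 hθ hτ _ hBU hΩ hsub x hx hρx g F D Db Df hF hsuppg hD hsD hDb hsDb hDf hsDf μ).trans
      (mul_le_mul_of_nonneg_left
        (bound_mono₂ hc₁.le hc1_0 hδ1_0 (mul_nonneg hPkinv hD) (mul_nonneg hPkinv (add_nonneg hDb hDf)) hF0) hsk.le)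
  · -- (H2): the value closeness for `□ ⊆ Ω` (every row of `□`)
    intro c' M' hM' hfit' hN' hsub x hx _ g F D Db Df hF hsuppg hD hsD hDb hsDb hDf hsDf
    have hF0 : 0 ≤ F := (norm_nonneg _).trans (hF x)
    have hBU : IsBlockUnion k (cubeT hPd (P.L ^ k) c' fun i => P.L ^ k * M' i) := isBlockUnion_cubeT hPd hkm rfl hfit'
    exact (H2p P hPd hPL k hk1 hkK hbig U Ω θ hθ0 hθ hτ _ hBU hΩ hsub x hx g F D Db Df hF hsuppg hD hsD hDb hsDb hDf hsDf).trans
      (mul_le_mul_of_nonneg_left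
        (bound_mono₂ hc₂.le hc2_0 hδ2_0 (mul_nonneg hPkinv hD) (mul_nonneg hPkinv (add_nonneg hDb hDf)) hF0) hsk2)
  · -- (H3): the (1.10) covariant-derivative member of `G_k(Ω,u)` at the `L^k`-deep rows of `Ω`
    intro x _ hρ μ g F D hF hD hsupp
    have hF0 : 0 ≤ F := (norm_nonneg _).trans (hF x)
    exact (HDΩ x (hballΩ x hρ) g F D hF hD hsupp μ).trans
      (mul_le_mul_of_nonneg_left (bound_mono hc₃ hc3_0 hδ3_0 (mul_nonneg hPkinv hD) hF0) hsk.le)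
  · -- (H4): the (1.10) value member of `G_k(Ω,u)` (every row of `Ω`)
    intro x hxΩ _ g F D hF hD hsupp
    have hF0 : 0 ≤ F := (norm_nonneg _).trans (hF x)
    exact (HVΩ x hxΩ g F D hF hD hsupp).trans
      (mul_le_mul_of_nonneg_left (bound_mono hc₃ hc3_0 hδ3_0 (mul_nonneg hPkinv hD) hF0) hsk2)

/-! ## §2 The members of (2.31) for a block-union region `Ω ⊇ Ω₀` under the printed local hypothesis — the four [6]-inputs discharged -/

set_option maxHeartbeats 400000 in
/-- **THE COVARIANT-DERIVATIVE ANALOGUE OF (2.31) FOR A `k`-BLOCK REGION `Ω ⊇ Ω₀` AT A `U(1)` FIELD PLAQUETTE-SMALL NEAR `Ω` ONLY** (p. 263 (2.31)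
+ *"Bounds analogous to (2.30), (2.31) hold for covariant derivatives …"*; [BalabanImbrieJaffe1985] p. 326 (7.3.1)): for `1 ≤ d`, `d + 1 ≤ 3`,
`ℓ ≥ 1`, `ℓ + 1` odd, `a > 0` THERE ARE `δ₀, C > 0` depending on `(d, ℓ, a)` only such that on every torus (`P.d = d+1`, `P.L = ℓ+1`), at every
`1 ≤ k ≤ K` with `2(L^k−1) + 4 < |T^{(0)}|`, every union `Ω` of `k`-blocks containing `Ω₀`, every field with `‖u(∂p) − 1‖ ≤ θ` for the
plaquettes based within `2L^k` of `Ω` only, `0 ≤ θ`, `(L^{2k}θ)² ≤ 1/500`, the printed data (`R > L^k + 1`), every bond with both ends in `Ω₀` at chart depth `≥ R₀ + R` and every `f`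
(`‖f‖_∞ ≤ F`) supported at sup-torus distance `≥ D ≥ 0` from `x`:
`‖D_u(G_{k,loc}(u)f)(x,μ) − D_u(G_k(Ω,u)f)(x,μ)‖ ≤ (L^kε)·C·[m(1 + L^k((R₀−R₁)⁻¹ + s⁻¹))e^{−δ₀(2R−1)/L^k} + (1 + L^k(R₀−R₁)⁻¹)e^{−(δ₀/2)(R₁−1)/L^k}]·
e^{−(δ₀/2)D/L^k}·F` — `deriv231_region_of_inputs` ∘ `inputs_smoothNear_region`.
[cite: BalabanImbrieJaffe1988, (2.31) p.263] [cite: BalabanImbrieJaffe1985, (7.3.1) p.326] -/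
theorem deriv231_smoothNear_region (d ℓ : ℕ) (hd1 : 1 ≤ d) (hd3 : d + 1 ≤ 3) (hℓ : 1 ≤ ℓ) (hodd : Odd (ℓ + 1)) {a : ℝ} (ha : 0 < a) :
    ∃ δ₀ C : ℝ, 0 < δ₀ ∧ 0 < C ∧ ∀ (P : Params) (hPd : P.d = d + 1), P.L = ℓ + 1 →
      ∀ (k : ℕ), 1 ≤ k → k ≤ P.K → 2 * (P.L ^ k - 1) + 4 < P.sitesPerDir 0 →
      ∀ (U : GaugeField P 0 U1) (Ω : Finset (Balaban1983to89.Site P 0)) (θ : ℝ), 0 ≤ θ →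
        (∀ p : Balaban1983to89.Plaq P 0, (∃ y ∈ Ω, supDist y p.src ≤ 2 * P.L ^ k) → ‖toC (plaqHol U p) - 1‖ ≤ θ) →
        (((P.L : ℝ) ^ k) ^ 2 * θ) ^ 2 ≤ 1 / 500 → IsBlockUnion k Ω →
      ∀ (c M0 : Fin (d + 1) → ℕ), (∀ i, 1 ≤ M0 i) →
        (∀ i, c i * P.L ^ k + P.L ^ k * M0 i ≤ P.sitesPerDir 0) → (∀ i, P.L ^ k * M0 i < P.sitesPerDir 0) →
        (cubeT hPd (P.L ^ k) c fun i => P.L ^ k * M0 i) ⊆ Ω →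
      ∀ (s W : ℕ), 1 ≤ s → ∀ (R R₀ R₁ : ℝ), (P.L : ℝ) ^ k + 1 < R → 0 ≤ R₁ → R₁ < R₀ → 2 * (s : ℝ) / 3 + R₀ / 2 + R ≤ W →
        (∀ i, ((P.L ^ k * M0 i : ℕ) : ℝ) + R ≤ P.sitesPerDir 0) →
      ∀ (x : Balaban1983to89.Site P 0) (μ : Fin P.d),
        x ∈ (cubeT hPd (P.L ^ k) c fun i => P.L ^ k * M0 i) →
        (∀ i, R₀ + R ≤ (boxCoord hPd (P.L ^ k) c x i : ℝ) ∧ (boxCoord hPd (P.L ^ k) c x i : ℝ) + (R₀ + R) ≤ (P.L ^ k * M0 i : ℕ) - 1) →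
        x.shift μ ∈ (cubeT hPd (P.L ^ k) c fun i => P.L ^ k * M0 i) →
        (∀ i, R₀ + R ≤ (boxCoord hPd (P.L ^ k) c (x.shift μ) i : ℝ) ∧
          (boxCoord hPd (P.L ^ k) c (x.shift μ) i : ℝ) + (R₀ + R) ≤ (P.L ^ k * M0 i : ℕ) - 1) →
      ∀ (f : Balaban1983to89.Site P 0 → ℂ) (F D : ℝ), (∀ y, ‖f y‖ ≤ F) → 0 ≤ D → (∀ y, f y ≠ 0 → D ≤ B5Ineq137Torus.T P 0 x y) →
        ‖covD P.eps⁻¹ (cfg U)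
              (gLocT (B1RG242Torus.α P a k * (P.L : ℝ) ^ (k * P.d)) P.eps⁻¹ U k
                (cubeFam hPd (P.L ^ k) c M0 s W) (lamFam hPd (P.L ^ k) c M0 s) (cutoff R₁ R₀ (B5Ineq137Torus.T P 0)) *ᵥ f) ⟨x, μ⟩ -
            covD P.eps⁻¹ (cfg U) (gBox (B1RG242Torus.α P a k * (P.L : ℝ) ^ (k * P.d)) P.eps⁻¹ U k Ω *ᵥ f) ⟨x, μ⟩‖ ≤
          P.spacing k * (C * ((⌊(((P.L : ℝ) ^ k) - 1 + R₀) / s⌋₊ + 3) ^ (d + 1) * (1 + (P.L : ℝ) ^ k * ((R₀ - R₁)⁻¹ + (s : ℝ)⁻¹)) *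
              Real.exp (-(δ₀ * (((P.L : ℝ) ^ k)⁻¹ * (2 * R - 1)))) +
            (1 + (P.L : ℝ) ^ k * (R₀ - R₁)⁻¹) * Real.exp (-(δ₀ / 2 * (((P.L : ℝ) ^ k)⁻¹ * (R₁ - 1))))) *
            Real.exp (-(δ₀ / 2 * (((P.L : ℝ) ^ k)⁻¹ * D))) * F) := by
  obtain ⟨δ₀, c₀, hδ₀, hc₀, HI⟩ := inputs_smoothNear_region d ℓ hd1 hd3 hℓ hodd ha
  obtain ⟨C, hC, G⟩ := deriv231_region_of_inputs d hc₀.le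
  refine ⟨δ₀, C, hδ₀, hC, ?_⟩
  intro P hPd hPL k hk1 hkK hbig U Ω θ hθ0 hθ hτ hΩbu c M0 hM0 hfit0 hN0 hΩ s W hs R R₀ R₁ hR hR₁ hR10 hW hgap x μ hx hdeep hxe hdeepe f F D
    hF hD hsupp
  obtain ⟨H1, H2, H3, H4⟩ := HI P hPd hPL k hk1 hkK hbig U Ω θ hθ0 hθ hτ hΩbu
  exact G P hPd a k hk1 hkK U Ω δ₀ ((P.L : ℝ) ^ k) hδ₀ (by positivity) H1 H2 H3 H4 c M0 hM0 hfit0 hN0 hΩ s W hs R R₀ R₁ hR hR₁ hR10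
    hW hgap x μ hx hdeep hxe hdeepe f F D hF hD hsupp

set_option maxHeartbeats 400000 in
/-- **THE HÖLDER MEMBER OF ORDER `θ' ≤ 1` OF (2.31) FOR A `k`-BLOCK REGION `Ω ⊇ Ω₀` AT A `U(1)` FIELD PLAQUETTE-SMALL NEAR `Ω` ONLY, ALONG EVERY
ADMISSIBLE CONTOUR** (p. 263: *"… Hölder derivatives of G_{k,loc}(u) of order less than two"*): with the same quantifiers, for every `0 ≤ θ' ≤ 1`,
every pair `x₁, x₂` joined by an admissible bond chain `Γ`, every `f` supported at sup-torus distance `≥ D` from both points,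
`ψ = G_{k,loc}(u)f − G_k(Ω,u)f`:
`(L^k/|x₁ − x₂|_T)^{θ'}·‖u(Γ)ψ(x₂) − ψ(x₁)‖ ≤ (L^kε)²·C·e^{δ₀/2}·[bracket of `deriv231_smoothNear_region`]·e^{−(δ₀/2)D/L^k}·F` —
`holder231_region_of_inputs` ∘ `inputs_smoothNear_region`.
[cite: BalabanImbrieJaffe1988, (2.31) p.263] [cite: BalabanImbrieJaffe1985, (7.3.1) p.326] [cite: Balaban1983RegularityDecay, Theorem p.573 (1.9)] -/
theorem holder231_smoothNear_region (d ℓ : ℕ) (hd1 : 1 ≤ d) (hd3 : d + 1 ≤ 3) (hℓ : 1 ≤ ℓ) (hodd : Odd (ℓ + 1)) {a : ℝ} (ha : 0 < a) :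
    ∃ δ₀ C : ℝ, 0 < δ₀ ∧ 0 < C ∧ ∀ (P : Params) (hPd : P.d = d + 1), P.L = ℓ + 1 →
      ∀ (k : ℕ), 1 ≤ k → k ≤ P.K → 2 * (P.L ^ k - 1) + 4 < P.sitesPerDir 0 →
      ∀ (U : GaugeField P 0 U1) (Ω : Finset (Balaban1983to89.Site P 0)) (θ : ℝ), 0 ≤ θ →
        (∀ p : Balaban1983to89.Plaq P 0, (∃ y ∈ Ω, supDist y p.src ≤ 2 * P.L ^ k) → ‖toC (plaqHol U p) - 1‖ ≤ θ) →
        (((P.L : ℝ) ^ k) ^ 2 * θ) ^ 2 ≤ 1 / 500 → IsBlockUnion k Ω →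
      ∀ (c M0 : Fin (d + 1) → ℕ), (∀ i, 1 ≤ M0 i) →
        (∀ i, c i * P.L ^ k + P.L ^ k * M0 i ≤ P.sitesPerDir 0) → (∀ i, P.L ^ k * M0 i < P.sitesPerDir 0) →
        (cubeT hPd (P.L ^ k) c fun i => P.L ^ k * M0 i) ⊆ Ω →
      ∀ (s W : ℕ), 1 ≤ s → ∀ (R R₀ R₁ : ℝ), (P.L : ℝ) ^ k + 1 < R → 0 ≤ R₁ → R₁ < R₀ → 2 * (s : ℝ) / 3 + R₀ / 2 + R ≤ W →
        (∀ i, ((P.L ^ k * M0 i : ℕ) : ℝ) + R ≤ P.sitesPerDir 0) →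
      ∀ (θ' : ℝ), 0 ≤ θ' → θ' ≤ 1 →
      ∀ (x₁ x₂ : Balaban1983to89.Site P 0) (n : ℕ) (sq : ℕ → Balaban1983to89.Site P 0) (cb : ℕ → PBond P 0),
        sq 0 = x₁ → sq n = x₂ → (∀ m < n, Joins (cb m) (sq m) (sq (m + 1))) →
        (n : ℝ) ≤ ((d : ℝ) + 1) * B5Ineq137Torus.T P 0 x₁ x₂ →
        (∀ m ≤ n, sq m ∈ (cubeT hPd (P.L ^ k) c fun i => P.L ^ k * M0 i) ∧
          (∀ i, R₀ + R ≤ (boxCoord hPd (P.L ^ k) c (sq m) i : ℝ) ∧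
            (boxCoord hPd (P.L ^ k) c (sq m) i : ℝ) + (R₀ + R) ≤ (P.L ^ k * M0 i : ℕ) - 1) ∧
          B5Ineq137Torus.T P 0 x₁ (sq m) ≤ B5Ineq137Torus.T P 0 x₁ x₂) →
      ∀ (f : Balaban1983to89.Site P 0 → ℂ) (F D : ℝ), (∀ y, ‖f y‖ ≤ F) → 0 ≤ D →
        (∀ y, f y ≠ 0 → D ≤ B5Ineq137Torus.T P 0 x₁ y) → (∀ y, f y ≠ 0 → D ≤ B5Ineq137Torus.T P 0 x₂ y) →
        ((P.L : ℝ) ^ k / B5Ineq137Torus.T P 0 x₁ x₂) ^ θ' *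
          ‖toC (chainHol sq cb U n) *
              ((gLocT (B1RG242Torus.α P a k * (P.L : ℝ) ^ (k * P.d)) P.eps⁻¹ U k
                  (cubeFam hPd (P.L ^ k) c M0 s W) (lamFam hPd (P.L ^ k) c M0 s) (cutoff R₁ R₀ (B5Ineq137Torus.T P 0)) *ᵥ f) x₂ -
                (gBox (B1RG242Torus.α P a k * (P.L : ℝ) ^ (k * P.d)) P.eps⁻¹ U k Ω *ᵥ f) x₂) -
            ((gLocT (B1RG242Torus.α P a k * (P.L : ℝ) ^ (k * P.d)) P.eps⁻¹ U k
                  (cubeFam hPd (P.L ^ k) c M0 s W) (lamFam hPd (P.L ^ k) c M0 s) (cutoff R₁ R₀ (B5Ineq137Torus.T P 0)) *ᵥ f) x₁ -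
                (gBox (B1RG242Torus.α P a k * (P.L : ℝ) ^ (k * P.d)) P.eps⁻¹ U k Ω *ᵥ f) x₁)‖ ≤
          P.spacing k ^ 2 * (C * Real.exp (δ₀ / 2) *
            ((⌊(((P.L : ℝ) ^ k) - 1 + R₀) / s⌋₊ + 3) ^ (d + 1) * (1 + (P.L : ℝ) ^ k * ((R₀ - R₁)⁻¹ + (s : ℝ)⁻¹)) *
              Real.exp (-(δ₀ * (((P.L : ℝ) ^ k)⁻¹ * (2 * R - 1)))) +
            (1 + (P.L : ℝ) ^ k * (R₀ - R₁)⁻¹) * Real.exp (-(δ₀ / 2 * (((P.L : ℝ) ^ k)⁻¹ * (R₁ - 1))))) *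
            Real.exp (-(δ₀ / 2 * (((P.L : ℝ) ^ k)⁻¹ * D))) * F) := by
  obtain ⟨δ₀, c₀, hδ₀, hc₀, HI⟩ := inputs_smoothNear_region d ℓ hd1 hd3 hℓ hodd ha
  obtain ⟨C, hC, G⟩ := holder231_region_of_inputs d hc₀.le
  refine ⟨δ₀, C, hδ₀, hC, ?_⟩
  intro P hPd hPL k hk1 hkK hbig U Ω θ hθ0 hθ hτ hΩbu c M0 hM0 hfit0 hN0 hΩ s W hs R R₀ R₁ hR hR₁ hR10 hW hgap θ' hθ'0 hθ'1
    x₁ x₂ n sq cb hsq0 hsqn hJ hnle hchain f F D hF hD hsupp₁ hsupp₂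
  obtain ⟨H1, H2, H3, H4⟩ := HI P hPd hPL k hk1 hkK hbig U Ω θ hθ0 hθ hτ hΩbu
  exact G P hPd a k hk1 hkK U Ω δ₀ ((P.L : ℝ) ^ k) hδ₀ (by positivity) H1 H2 H3 H4 c M0 hM0 hfit0 hN0 hΩ s W hs R R₀ R₁ hR hR₁ hR10
    hW hgap θ' hθ'0 hθ'1 x₁ x₂ n sq cb hsq0 hsqn hJ hnle hchain f F D hF hD hsupp₁ hsupp₂

/-- **THE SAME ALONG THE CHART STAIRCASE**: for every pair `x₁, x₂ ∈ Ω₀` at chart depth `≥ R₀ + R` with `|x₁ − x₂|_T ≤ R₀ + R` THERE IS a bond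
chain of `≤ (d+1)|x₁ − x₂|_T` steps along which the bound of `holder231_smoothNear_region` holds for every `θ'` and `f`.
[cite: BalabanImbrieJaffe1988, (2.31) p.263] [cite: Balaban1983RegularityDecay, Theorem p.573 (1.9)] -/
theorem exists_contour_holder231_smoothNear_region (d ℓ : ℕ) (hd1 : 1 ≤ d) (hd3 : d + 1 ≤ 3) (hℓ : 1 ≤ ℓ) (hodd : Odd (ℓ + 1))
    {a : ℝ} (ha : 0 < a) :
    ∃ δ₀ C : ℝ, 0 < δ₀ ∧ 0 < C ∧ ∀ (P : Params) (hPd : P.d = d + 1), P.L = ℓ + 1 →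
      ∀ (k : ℕ), 1 ≤ k → k ≤ P.K → 2 * (P.L ^ k - 1) + 4 < P.sitesPerDir 0 →
      ∀ (U : GaugeField P 0 U1) (Ω : Finset (Balaban1983to89.Site P 0)) (θ : ℝ), 0 ≤ θ →
        (∀ p : Balaban1983to89.Plaq P 0, (∃ y ∈ Ω, supDist y p.src ≤ 2 * P.L ^ k) → ‖toC (plaqHol U p) - 1‖ ≤ θ) →
        (((P.L : ℝ) ^ k) ^ 2 * θ) ^ 2 ≤ 1 / 500 → IsBlockUnion k Ω →
      ∀ (c M0 : Fin (d + 1) → ℕ), (∀ i, 1 ≤ M0 i) →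
        (∀ i, c i * P.L ^ k + P.L ^ k * M0 i ≤ P.sitesPerDir 0) → (∀ i, P.L ^ k * M0 i < P.sitesPerDir 0) →
        (cubeT hPd (P.L ^ k) c fun i => P.L ^ k * M0 i) ⊆ Ω →
      ∀ (s W : ℕ), 1 ≤ s → ∀ (R R₀ R₁ : ℝ), (P.L : ℝ) ^ k + 1 < R → 0 ≤ R₁ → R₁ < R₀ → 2 * (s : ℝ) / 3 + R₀ / 2 + R ≤ W →
        (∀ i, ((P.L ^ k * M0 i : ℕ) : ℝ) + R ≤ P.sitesPerDir 0) →
      ∀ (x₁ x₂ : Balaban1983to89.Site P 0),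
        x₁ ∈ (cubeT hPd (P.L ^ k) c fun i => P.L ^ k * M0 i) →
        (∀ i, R₀ + R ≤ (boxCoord hPd (P.L ^ k) c x₁ i : ℝ) ∧ (boxCoord hPd (P.L ^ k) c x₁ i : ℝ) + (R₀ + R) ≤ (P.L ^ k * M0 i : ℕ) - 1) →
        x₂ ∈ (cubeT hPd (P.L ^ k) c fun i => P.L ^ k * M0 i) →
        (∀ i, R₀ + R ≤ (boxCoord hPd (P.L ^ k) c x₂ i : ℝ) ∧ (boxCoord hPd (P.L ^ k) c x₂ i : ℝ) + (R₀ + R) ≤ (P.L ^ k * M0 i : ℕ) - 1) →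
        B5Ineq137Torus.T P 0 x₁ x₂ ≤ R₀ + R →
      ∃ (N : ℕ) (sq : ℕ → Balaban1983to89.Site P 0) (cb : ℕ → PBond P 0), sq 0 = x₁ ∧ sq N = x₂ ∧
        (∀ m < N, Joins (cb m) (sq m) (sq (m + 1))) ∧ (N : ℝ) ≤ ((d : ℝ) + 1) * B5Ineq137Torus.T P 0 x₁ x₂ ∧
      ∀ (θ' : ℝ), 0 ≤ θ' → θ' ≤ 1 →
      ∀ (f : Balaban1983to89.Site P 0 → ℂ) (F D : ℝ), (∀ y, ‖f y‖ ≤ F) → 0 ≤ D →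
        (∀ y, f y ≠ 0 → D ≤ B5Ineq137Torus.T P 0 x₁ y) → (∀ y, f y ≠ 0 → D ≤ B5Ineq137Torus.T P 0 x₂ y) →
        ((P.L : ℝ) ^ k / B5Ineq137Torus.T P 0 x₁ x₂) ^ θ' *
          ‖toC (chainHol sq cb U N) *
              ((gLocT (B1RG242Torus.α P a k * (P.L : ℝ) ^ (k * P.d)) P.eps⁻¹ U k
                  (cubeFam hPd (P.L ^ k) c M0 s W) (lamFam hPd (P.L ^ k) c M0 s) (cutoff R₁ R₀ (B5Ineq137Torus.T P 0)) *ᵥ f) x₂ -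
                (gBox (B1RG242Torus.α P a k * (P.L : ℝ) ^ (k * P.d)) P.eps⁻¹ U k Ω *ᵥ f) x₂) -
            ((gLocT (B1RG242Torus.α P a k * (P.L : ℝ) ^ (k * P.d)) P.eps⁻¹ U k
                  (cubeFam hPd (P.L ^ k) c M0 s W) (lamFam hPd (P.L ^ k) c M0 s) (cutoff R₁ R₀ (B5Ineq137Torus.T P 0)) *ᵥ f) x₁ -
                (gBox (B1RG242Torus.α P a k * (P.L : ℝ) ^ (k * P.d)) P.eps⁻¹ U k Ω *ᵥ f) x₁)‖ ≤
          P.spacing k ^ 2 * (C * Real.exp (δ₀ / 2) *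
            ((⌊(((P.L : ℝ) ^ k) - 1 + R₀) / s⌋₊ + 3) ^ (d + 1) * (1 + (P.L : ℝ) ^ k * ((R₀ - R₁)⁻¹ + (s : ℝ)⁻¹)) *
              Real.exp (-(δ₀ * (((P.L : ℝ) ^ k)⁻¹ * (2 * R - 1)))) +
            (1 + (P.L : ℝ) ^ k * (R₀ - R₁)⁻¹) * Real.exp (-(δ₀ / 2 * (((P.L : ℝ) ^ k)⁻¹ * (R₁ - 1))))) *
            Real.exp (-(δ₀ / 2 * (((P.L : ℝ) ^ k)⁻¹ * D))) * F) := by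
  obtain ⟨δ₀, c₀, hδ₀, hc₀, HI⟩ := inputs_smoothNear_region d ℓ hd1 hd3 hℓ hodd ha
  obtain ⟨C, hC, G⟩ := exists_contour_holder231_region_of_inputs d hc₀.le
  refine ⟨δ₀, C, hδ₀, hC, ?_⟩
  intro P hPd hPL k hk1 hkK hbig U Ω θ hθ0 hθ hτ hΩbu c M0 hM0 hfit0 hN0 hΩ s W hs R R₀ R₁ hR hR₁ hR10 hW hgap x₁ x₂ hx₁ hdeep₁ hx₂
    hdeep₂ hT
  obtain ⟨H1, H2, H3, H4⟩ := HI P hPd hPL k hk1 hkK hbig U Ω θ hθ0 hθ hτ hΩbu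
  exact G P hPd a k hk1 hkK U Ω δ₀ ((P.L : ℝ) ^ k) hδ₀ (by positivity) H1 H2 H3 H4 c M0 hM0 hfit0 hN0 hΩ s W hs R R₀ R₁ hR hR₁ hR10
    hW hgap x₁ x₂ hx₁ hdeep₁ hx₂ hdeep₂ hT


/-! ## §3 The three members under r18's typed (2.32) `SmoothOn` near `Ω` -/

set_option maxHeartbeats 400000 in
/-- **THE COVARIANT-DERIVATIVE ANALOGUE OF (2.31) FOR A `k`-BLOCK REGION `Ω ⊇ Ω₀` UNDER THE PRINTED (2.32)** (p. 263: *"for (2.31) we assume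
smoothness throughout the subset Ω ⊂ T_η. This means that in a neighborhood of each □_α there exists an A, λ such that u = exp[ie_kη(A + ∂λ)] with
|∂A|, |∂*A| ≦ O(p(e_k)). (2.32)"*): `deriv231_smoothNear_region` with the local plaquette hypothesis DISCHARGED from r18's `SmoothOn e_k η C_s 𝓅 X Bd Pl
(cfg u)` whenever `Pl` contains the plaquettes based within `2L^k` of `Ω` and `Bd` their bonds (p34's `plaqSmall_near_of_smoothOn`), threshold
`(L^{2k}·e_kη²C_s𝓅)² ≤ 1/500` (`0 ≤ e_k`, `0 ≤ C_s𝓅`). [cite: BalabanImbrieJaffe1988, (2.31)–(2.32) p.263] [cite: BalabanImbrieJaffe1985, (7.3.1) p.326] -/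
theorem deriv231_smoothOn_region (d ℓ : ℕ) (hd1 : 1 ≤ d) (hd3 : d + 1 ≤ 3) (hℓ : 1 ≤ ℓ) (hodd : Odd (ℓ + 1)) {a : ℝ} (ha : 0 < a) :
    ∃ δ₀ C : ℝ, 0 < δ₀ ∧ 0 < C ∧ ∀ (P : Params) (hPd : P.d = d + 1), P.L = ℓ + 1 →
      ∀ (k : ℕ), 1 ≤ k → k ≤ P.K → 2 * (P.L ^ k - 1) + 4 < P.sitesPerDir 0 →
      ∀ (U : GaugeField P 0 U1) (Ω : Finset (Balaban1983to89.Site P 0)) (ek η Cs pek : ℝ), 0 ≤ ek → 0 ≤ Cs * pek →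
      ∀ (X : Finset (Balaban1983to89.Site P 0)) (Bd : Finset (PBond P 0)) (Pl : Finset (Balaban1983to89.Plaq P 0)),
        SmoothOn ek η Cs pek X Bd Pl (cfg U) →
        (∀ p : Balaban1983to89.Plaq P 0, (∃ y ∈ Ω, supDist y p.src ≤ 2 * P.L ^ k) → p ∈ Pl) →
        (∀ p ∈ Pl, (⟨p.src, p.μ⟩ : PBond P 0) ∈ Bd ∧ (⟨p.src.shift p.μ, p.ν⟩ : PBond P 0) ∈ Bd ∧
          (⟨p.src.shift p.ν, p.μ⟩ : PBond P 0) ∈ Bd ∧ (⟨p.src, p.ν⟩ : PBond P 0) ∈ Bd) →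
        (((P.L : ℝ) ^ k) ^ 2 * (ek * η ^ 2 * (Cs * pek))) ^ 2 ≤ 1 / 500 → IsBlockUnion k Ω →
      ∀ (c M0 : Fin (d + 1) → ℕ), (∀ i, 1 ≤ M0 i) →
        (∀ i, c i * P.L ^ k + P.L ^ k * M0 i ≤ P.sitesPerDir 0) → (∀ i, P.L ^ k * M0 i < P.sitesPerDir 0) →
        (cubeT hPd (P.L ^ k) c fun i => P.L ^ k * M0 i) ⊆ Ω →
      ∀ (s W : ℕ), 1 ≤ s → ∀ (R R₀ R₁ : ℝ), (P.L : ℝ) ^ k + 1 < R → 0 ≤ R₁ → R₁ < R₀ → 2 * (s : ℝ) / 3 + R₀ / 2 + R ≤ W →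
        (∀ i, ((P.L ^ k * M0 i : ℕ) : ℝ) + R ≤ P.sitesPerDir 0) →
      ∀ (x : Balaban1983to89.Site P 0) (μ : Fin P.d),
        x ∈ (cubeT hPd (P.L ^ k) c fun i => P.L ^ k * M0 i) →
        (∀ i, R₀ + R ≤ (boxCoord hPd (P.L ^ k) c x i : ℝ) ∧ (boxCoord hPd (P.L ^ k) c x i : ℝ) + (R₀ + R) ≤ (P.L ^ k * M0 i : ℕ) - 1) →
        x.shift μ ∈ (cubeT hPd (P.L ^ k) c fun i => P.L ^ k * M0 i) →
        (∀ i, R₀ + R ≤ (boxCoord hPd (P.L ^ k) c (x.shift μ) i : ℝ) ∧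
          (boxCoord hPd (P.L ^ k) c (x.shift μ) i : ℝ) + (R₀ + R) ≤ (P.L ^ k * M0 i : ℕ) - 1) →
      ∀ (f : Balaban1983to89.Site P 0 → ℂ) (F D : ℝ), (∀ y, ‖f y‖ ≤ F) → 0 ≤ D → (∀ y, f y ≠ 0 → D ≤ B5Ineq137Torus.T P 0 x y) →
        ‖covD P.eps⁻¹ (cfg U)
              (gLocT (B1RG242Torus.α P a k * (P.L : ℝ) ^ (k * P.d)) P.eps⁻¹ U k
                (cubeFam hPd (P.L ^ k) c M0 s W) (lamFam hPd (P.L ^ k) c M0 s) (cutoff R₁ R₀ (B5Ineq137Torus.T P 0)) *ᵥ f) ⟨x, μ⟩ -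
            covD P.eps⁻¹ (cfg U) (gBox (B1RG242Torus.α P a k * (P.L : ℝ) ^ (k * P.d)) P.eps⁻¹ U k Ω *ᵥ f) ⟨x, μ⟩‖ ≤
          P.spacing k * (C * ((⌊(((P.L : ℝ) ^ k) - 1 + R₀) / s⌋₊ + 3) ^ (d + 1) * (1 + (P.L : ℝ) ^ k * ((R₀ - R₁)⁻¹ + (s : ℝ)⁻¹)) *
              Real.exp (-(δ₀ * (((P.L : ℝ) ^ k)⁻¹ * (2 * R - 1)))) +
            (1 + (P.L : ℝ) ^ k * (R₀ - R₁)⁻¹) * Real.exp (-(δ₀ / 2 * (((P.L : ℝ) ^ k)⁻¹ * (R₁ - 1))))) *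
            Real.exp (-(δ₀ / 2 * (((P.L : ℝ) ^ k)⁻¹ * D))) * F) := by
  obtain ⟨δ₀, C₀, hδ₀, hC₀, H⟩ := deriv231_smoothNear_region d ℓ hd1 hd3 hℓ hodd ha
  refine ⟨δ₀, C₀, hδ₀, hC₀, ?_⟩
  intro P hPd hPL k hk1 hkK hbig U Ω ek η Cs pek hek hCp X Bd Pl hS hPl hBd hτ hΩbu c M0 hM0 hfit0 hN0 hΩ s W hs R R₀ R₁ hR hR₁ hR10 hW
    hgap x μ hx hdeep hxe hdeepe f F D hF hD hsupp
  exact H P hPd hPL k hk1 hkK hbig U Ω (ek * η ^ 2 * (Cs * pek)) (by positivity) (plaqSmall_near_of_smoothOn hek hS hPl hBd) hτ hΩbu c M0 hM0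
    hfit0 hN0 hΩ s W hs R R₀ R₁ hR hR₁ hR10 hW hgap x μ hx hdeep hxe hdeepe f F D hF hD hsupp

set_option maxHeartbeats 400000 in
/-- **THE HÖLDER-`θ' ≤ 1` MEMBER OF (2.31) FOR `Ω ⊇ Ω₀` UNDER THE PRINTED (2.32), ALONG EVERY ADMISSIBLE CONTOUR**: `holder231_smoothNear_region` with the
local plaquette hypothesis discharged from r18's `SmoothOn` near `Ω` (p34's `plaqSmall_near_of_smoothOn`).
[cite: BalabanImbrieJaffe1988, (2.31)–(2.32) p.263] [cite: Balaban1983RegularityDecay, Theorem p.573 (1.9)] -/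
theorem holder231_smoothOn_region (d ℓ : ℕ) (hd1 : 1 ≤ d) (hd3 : d + 1 ≤ 3) (hℓ : 1 ≤ ℓ) (hodd : Odd (ℓ + 1)) {a : ℝ} (ha : 0 < a) :
    ∃ δ₀ C : ℝ, 0 < δ₀ ∧ 0 < C ∧ ∀ (P : Params) (hPd : P.d = d + 1), P.L = ℓ + 1 →
      ∀ (k : ℕ), 1 ≤ k → k ≤ P.K → 2 * (P.L ^ k - 1) + 4 < P.sitesPerDir 0 →
      ∀ (U : GaugeField P 0 U1) (Ω : Finset (Balaban1983to89.Site P 0)) (ek η Cs pek : ℝ), 0 ≤ ek → 0 ≤ Cs * pek →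
      ∀ (X : Finset (Balaban1983to89.Site P 0)) (Bd : Finset (PBond P 0)) (Pl : Finset (Balaban1983to89.Plaq P 0)),
        SmoothOn ek η Cs pek X Bd Pl (cfg U) →
        (∀ p : Balaban1983to89.Plaq P 0, (∃ y ∈ Ω, supDist y p.src ≤ 2 * P.L ^ k) → p ∈ Pl) →
        (∀ p ∈ Pl, (⟨p.src, p.μ⟩ : PBond P 0) ∈ Bd ∧ (⟨p.src.shift p.μ, p.ν⟩ : PBond P 0) ∈ Bd ∧
          (⟨p.src.shift p.ν, p.μ⟩ : PBond P 0) ∈ Bd ∧ (⟨p.src, p.ν⟩ : PBond P 0) ∈ Bd) →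
        (((P.L : ℝ) ^ k) ^ 2 * (ek * η ^ 2 * (Cs * pek))) ^ 2 ≤ 1 / 500 → IsBlockUnion k Ω →
      ∀ (c M0 : Fin (d + 1) → ℕ), (∀ i, 1 ≤ M0 i) →
        (∀ i, c i * P.L ^ k + P.L ^ k * M0 i ≤ P.sitesPerDir 0) → (∀ i, P.L ^ k * M0 i < P.sitesPerDir 0) →
        (cubeT hPd (P.L ^ k) c fun i => P.L ^ k * M0 i) ⊆ Ω →
      ∀ (s W : ℕ), 1 ≤ s → ∀ (R R₀ R₁ : ℝ), (P.L : ℝ) ^ k + 1 < R → 0 ≤ R₁ → R₁ < R₀ → 2 * (s : ℝ) / 3 + R₀ / 2 + R ≤ W →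
        (∀ i, ((P.L ^ k * M0 i : ℕ) : ℝ) + R ≤ P.sitesPerDir 0) →
      ∀ (θ' : ℝ), 0 ≤ θ' → θ' ≤ 1 →
      ∀ (x₁ x₂ : Balaban1983to89.Site P 0) (n : ℕ) (sq : ℕ → Balaban1983to89.Site P 0) (cb : ℕ → PBond P 0),
        sq 0 = x₁ → sq n = x₂ → (∀ m < n, Joins (cb m) (sq m) (sq (m + 1))) →
        (n : ℝ) ≤ ((d : ℝ) + 1) * B5Ineq137Torus.T P 0 x₁ x₂ →
        (∀ m ≤ n, sq m ∈ (cubeT hPd (P.L ^ k) c fun i => P.L ^ k * M0 i) ∧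
          (∀ i, R₀ + R ≤ (boxCoord hPd (P.L ^ k) c (sq m) i : ℝ) ∧
            (boxCoord hPd (P.L ^ k) c (sq m) i : ℝ) + (R₀ + R) ≤ (P.L ^ k * M0 i : ℕ) - 1) ∧
          B5Ineq137Torus.T P 0 x₁ (sq m) ≤ B5Ineq137Torus.T P 0 x₁ x₂) →
      ∀ (f : Balaban1983to89.Site P 0 → ℂ) (F D : ℝ), (∀ y, ‖f y‖ ≤ F) → 0 ≤ D →
        (∀ y, f y ≠ 0 → D ≤ B5Ineq137Torus.T P 0 x₁ y) → (∀ y, f y ≠ 0 → D ≤ B5Ineq137Torus.T P 0 x₂ y) →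
        ((P.L : ℝ) ^ k / B5Ineq137Torus.T P 0 x₁ x₂) ^ θ' *
          ‖toC (chainHol sq cb U n) *
              ((gLocT (B1RG242Torus.α P a k * (P.L : ℝ) ^ (k * P.d)) P.eps⁻¹ U k
                  (cubeFam hPd (P.L ^ k) c M0 s W) (lamFam hPd (P.L ^ k) c M0 s) (cutoff R₁ R₀ (B5Ineq137Torus.T P 0)) *ᵥ f) x₂ -
                (gBox (B1RG242Torus.α P a k * (P.L : ℝ) ^ (k * P.d)) P.eps⁻¹ U k Ω *ᵥ f) x₂) -
            ((gLocT (B1RG242Torus.α P a k * (P.L : ℝ) ^ (k * P.d)) P.eps⁻¹ U k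
                  (cubeFam hPd (P.L ^ k) c M0 s W) (lamFam hPd (P.L ^ k) c M0 s) (cutoff R₁ R₀ (B5Ineq137Torus.T P 0)) *ᵥ f) x₁ -
                (gBox (B1RG242Torus.α P a k * (P.L : ℝ) ^ (k * P.d)) P.eps⁻¹ U k Ω *ᵥ f) x₁)‖ ≤
          P.spacing k ^ 2 * (C * Real.exp (δ₀ / 2) *
            ((⌊(((P.L : ℝ) ^ k) - 1 + R₀) / s⌋₊ + 3) ^ (d + 1) * (1 + (P.L : ℝ) ^ k * ((R₀ - R₁)⁻¹ + (s : ℝ)⁻¹)) *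
              Real.exp (-(δ₀ * (((P.L : ℝ) ^ k)⁻¹ * (2 * R - 1)))) +
            (1 + (P.L : ℝ) ^ k * (R₀ - R₁)⁻¹) * Real.exp (-(δ₀ / 2 * (((P.L : ℝ) ^ k)⁻¹ * (R₁ - 1))))) *
            Real.exp (-(δ₀ / 2 * (((P.L : ℝ) ^ k)⁻¹ * D))) * F) := by
  obtain ⟨δ₀, C₀, hδ₀, hC₀, H⟩ := holder231_smoothNear_region d ℓ hd1 hd3 hℓ hodd ha
  refine ⟨δ₀, C₀, hδ₀, hC₀, ?_⟩
  intro P hPd hPL k hk1 hkK hbig U Ω ek η Cs pek hek hCp X Bd Pl hS hPl hBd hτ hΩbu c M0 hM0 hfit0 hN0 hΩ s W hs R R₀ R₁ hR hR₁ hR10 hW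
    hgap θ' hθ'0 hθ'1 x₁ x₂ n sq cb hsq0 hsqn hJ hnle hchain f F D hF hD hsupp₁ hsupp₂
  exact H P hPd hPL k hk1 hkK hbig U Ω (ek * η ^ 2 * (Cs * pek)) (by positivity) (plaqSmall_near_of_smoothOn hek hS hPl hBd) hτ hΩbu c M0 hM0
    hfit0 hN0 hΩ s W hs R R₀ R₁ hR hR₁ hR10 hW hgap θ' hθ'0 hθ'1 x₁ x₂ n sq cb hsq0 hsqn hJ hnle hchain f F D hF hD hsupp₁ hsupp₂

/-- **THE SAME ALONG THE CHART STAIRCASE, UNDER THE PRINTED (2.32)**: `exists_contour_holder231_smoothNear_region` with the local plaquette hypothesis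
discharged from r18's `SmoothOn` near `Ω`. [cite: BalabanImbrieJaffe1988, (2.31)–(2.32) p.263] [cite: Balaban1983RegularityDecay, Theorem p.573 (1.9)] -/
theorem exists_contour_holder231_smoothOn_region (d ℓ : ℕ) (hd1 : 1 ≤ d) (hd3 : d + 1 ≤ 3) (hℓ : 1 ≤ ℓ) (hodd : Odd (ℓ + 1))
    {a : ℝ} (ha : 0 < a) :
    ∃ δ₀ C : ℝ, 0 < δ₀ ∧ 0 < C ∧ ∀ (P : Params) (hPd : P.d = d + 1), P.L = ℓ + 1 →
      ∀ (k : ℕ), 1 ≤ k → k ≤ P.K → 2 * (P.L ^ k - 1) + 4 < P.sitesPerDir 0 →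
      ∀ (U : GaugeField P 0 U1) (Ω : Finset (Balaban1983to89.Site P 0)) (ek η Cs pek : ℝ), 0 ≤ ek → 0 ≤ Cs * pek →
      ∀ (X : Finset (Balaban1983to89.Site P 0)) (Bd : Finset (PBond P 0)) (Pl : Finset (Balaban1983to89.Plaq P 0)),
        SmoothOn ek η Cs pek X Bd Pl (cfg U) →
        (∀ p : Balaban1983to89.Plaq P 0, (∃ y ∈ Ω, supDist y p.src ≤ 2 * P.L ^ k) → p ∈ Pl) →
        (∀ p ∈ Pl, (⟨p.src, p.μ⟩ : PBond P 0) ∈ Bd ∧ (⟨p.src.shift p.μ, p.ν⟩ : PBond P 0) ∈ Bd ∧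
          (⟨p.src.shift p.ν, p.μ⟩ : PBond P 0) ∈ Bd ∧ (⟨p.src, p.ν⟩ : PBond P 0) ∈ Bd) →
        (((P.L : ℝ) ^ k) ^ 2 * (ek * η ^ 2 * (Cs * pek))) ^ 2 ≤ 1 / 500 → IsBlockUnion k Ω →
      ∀ (c M0 : Fin (d + 1) → ℕ), (∀ i, 1 ≤ M0 i) →
        (∀ i, c i * P.L ^ k + P.L ^ k * M0 i ≤ P.sitesPerDir 0) → (∀ i, P.L ^ k * M0 i < P.sitesPerDir 0) →
        (cubeT hPd (P.L ^ k) c fun i => P.L ^ k * M0 i) ⊆ Ω →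
      ∀ (s W : ℕ), 1 ≤ s → ∀ (R R₀ R₁ : ℝ), (P.L : ℝ) ^ k + 1 < R → 0 ≤ R₁ → R₁ < R₀ → 2 * (s : ℝ) / 3 + R₀ / 2 + R ≤ W →
        (∀ i, ((P.L ^ k * M0 i : ℕ) : ℝ) + R ≤ P.sitesPerDir 0) →
      ∀ (x₁ x₂ : Balaban1983to89.Site P 0),
        x₁ ∈ (cubeT hPd (P.L ^ k) c fun i => P.L ^ k * M0 i) →
        (∀ i, R₀ + R ≤ (boxCoord hPd (P.L ^ k) c x₁ i : ℝ) ∧ (boxCoord hPd (P.L ^ k) c x₁ i : ℝ) + (R₀ + R) ≤ (P.L ^ k * M0 i : ℕ) - 1) →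
        x₂ ∈ (cubeT hPd (P.L ^ k) c fun i => P.L ^ k * M0 i) →
        (∀ i, R₀ + R ≤ (boxCoord hPd (P.L ^ k) c x₂ i : ℝ) ∧ (boxCoord hPd (P.L ^ k) c x₂ i : ℝ) + (R₀ + R) ≤ (P.L ^ k * M0 i : ℕ) - 1) →
        B5Ineq137Torus.T P 0 x₁ x₂ ≤ R₀ + R →
      ∃ (N : ℕ) (sq : ℕ → Balaban1983to89.Site P 0) (cb : ℕ → PBond P 0), sq 0 = x₁ ∧ sq N = x₂ ∧
        (∀ m < N, Joins (cb m) (sq m) (sq (m + 1))) ∧ (N : ℝ) ≤ ((d : ℝ) + 1) * B5Ineq137Torus.T P 0 x₁ x₂ ∧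
      ∀ (θ' : ℝ), 0 ≤ θ' → θ' ≤ 1 →
      ∀ (f : Balaban1983to89.Site P 0 → ℂ) (F D : ℝ), (∀ y, ‖f y‖ ≤ F) → 0 ≤ D →
        (∀ y, f y ≠ 0 → D ≤ B5Ineq137Torus.T P 0 x₁ y) → (∀ y, f y ≠ 0 → D ≤ B5Ineq137Torus.T P 0 x₂ y) →
        ((P.L : ℝ) ^ k / B5Ineq137Torus.T P 0 x₁ x₂) ^ θ' *
          ‖toC (chainHol sq cb U N) *
              ((gLocT (B1RG242Torus.α P a k * (P.L : ℝ) ^ (k * P.d)) P.eps⁻¹ U k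
                  (cubeFam hPd (P.L ^ k) c M0 s W) (lamFam hPd (P.L ^ k) c M0 s) (cutoff R₁ R₀ (B5Ineq137Torus.T P 0)) *ᵥ f) x₂ -
                (gBox (B1RG242Torus.α P a k * (P.L : ℝ) ^ (k * P.d)) P.eps⁻¹ U k Ω *ᵥ f) x₂) -
            ((gLocT (B1RG242Torus.α P a k * (P.L : ℝ) ^ (k * P.d)) P.eps⁻¹ U k
                  (cubeFam hPd (P.L ^ k) c M0 s W) (lamFam hPd (P.L ^ k) c M0 s) (cutoff R₁ R₀ (B5Ineq137Torus.T P 0)) *ᵥ f) x₁ -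
                (gBox (B1RG242Torus.α P a k * (P.L : ℝ) ^ (k * P.d)) P.eps⁻¹ U k Ω *ᵥ f) x₁)‖ ≤
          P.spacing k ^ 2 * (C * Real.exp (δ₀ / 2) *
            ((⌊(((P.L : ℝ) ^ k) - 1 + R₀) / s⌋₊ + 3) ^ (d + 1) * (1 + (P.L : ℝ) ^ k * ((R₀ - R₁)⁻¹ + (s : ℝ)⁻¹)) *
              Real.exp (-(δ₀ * (((P.L : ℝ) ^ k)⁻¹ * (2 * R - 1)))) +
            (1 + (P.L : ℝ) ^ k * (R₀ - R₁)⁻¹) * Real.exp (-(δ₀ / 2 * (((P.L : ℝ) ^ k)⁻¹ * (R₁ - 1))))) *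
            Real.exp (-(δ₀ / 2 * (((P.L : ℝ) ^ k)⁻¹ * D))) * F) := by
  obtain ⟨δ₀, C₀, hδ₀, hC₀, H⟩ := exists_contour_holder231_smoothNear_region d ℓ hd1 hd3 hℓ hodd ha
  refine ⟨δ₀, C₀, hδ₀, hC₀, ?_⟩
  intro P hPd hPL k hk1 hkK hbig U Ω ek η Cs pek hek hCp X Bd Pl hS hPl hBd hτ hΩbu c M0 hM0 hfit0 hN0 hΩ s W hs R R₀ R₁ hR hR₁ hR10 hW
    hgap x₁ x₂ hx₁ hdeep₁ hx₂ hdeep₂ hT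
  exact H P hPd hPL k hk1 hkK hbig U Ω (ek * η ^ 2 * (Cs * pek)) (by positivity) (plaqSmall_near_of_smoothOn hek hS hPl hBd) hτ hΩbu c M0 hM0
    hfit0 hN0 hΩ s W hs R R₀ R₁ hR hR₁ hR10 hW hgap x₁ x₂ hx₁ hdeep₁ hx₂ hdeep₂ hT

end

end Literature.MathematicalPhysics.QuantumFieldTheory.BalabanImbrieJaffe1984to88.BIJ88Loc231SmoothNearRegion
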